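import Summits.RiemannHypothesis.RiemannHypothesis.Theorems.GroundBartaGroundBartaFloorLeakageSign
import Summits.RiemannHypothesis.RiemannHypothesis.Theorems.GroundBartaGroundBartaFloorBartaPrelim
import Mathlib.Analysis.SpecialFunctions.ImproperIntegrals
import Mathlib.Analysis.SpecialFunctions.Integrals.Basic
import HarnessLib

/-!
# A lower bound for the leakage against a NEGATIVE part — preliminaries (route
`RiemannHypothesis/GroundBarta`, crux `PolarPerronFrobenius` stmt-RiemannHypothesis-18390; helper
towards an edge-tolerant Barta floor; part 1 of 2, the bound itself is in `…LeakageNeg`)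

Companion of the leakage sign lemma `stub_leakageSign` (file `…GroundBartaFloorLeakageSign`).
There, for a NON-NEGATIVE integrable `v` on the window `[-a, a]` and the leakage kernel
`κ = Φ(1 - χ)` of Riemann's kernel `Φ = weilThetaPhi` (`χ = 1` on `[-a, a]`, `0 ≤ χ ≤ 1`), the Weil
functional of `f = v ⋆ κ̃` was bounded ABOVE by its polar part, `Re W(v ⋆ κ̃) ≤ 2(∫ v cosh(t/2)) ϖ_a`.
Here we bound it BELOW, for a non-negative `w` (to be the negative part `(Re u)⁻` of a ground
state), by explicit, super-exponentially small multiples of `∫ w` and `√∫ w²`: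

  `Re W(w ⋆ κ̃) ≥ -(Π_a ∫ w + Φ(a)(4 √(∫ w²) + 8 ∫ w))`,
  `Π_a := 2 Σ' Λ(n) n^{-1/2} Φ(max a (log n - a))`                (`leakNeg_re_weilFunctional_ge`).

The three terms of `W = polar − prime + arch` for `f = w ⋆ κ̃ ≥ 0`, `f(0) = 0`:
* POLAR `= ŵ(0) conj κ̂(1) + ŵ(1) conj κ̂(0) ≥ 0` (all four factors are integrals of non-negative
  functions);
* PRIME `= Σ Λ(n) n^{-1/2}(f(log n) + f(−log n))` with `f(x) ≤ Φ(max a (|x| − a)) ∫ w`, because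
  `κ ≤ Φ(max a |s|)` pointwise (`κ` vanishes on the window and `Φ` decreases in `|s|`) and
  `|u − x| ≥ |x| − a` on the window;
* ARCHIMEDEAN, in Bombieri's form `−∫₀^∞ e^{t/2}(f(t) + f(−t))/(2 sinh t) dt` (`f(0) = 0`), with
  `f(±t) ≤ Φ(a) √t √(∫ w²)` (only the collar of width `t` at an edge sees the kernel; Cauchy–Schwarz)
  and `f(±t) ≤ Φ(a) ∫ w`; hence the integrand is `≤ 2Φ(a)√(∫w²) t^{-1/2}` on `(0, 1]` and
  `≤ 4Φ(a)(∫ w) e^{-t/2}` on `(1, ∞)`, which integrate to `4Φ(a)√(∫w²)` and `≤ 8Φ(a)∫w`.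
Elementary; the explicit formula in Bombieri's form (Bombieri 2000, Thm 2) is the only input.
[folklore]
-/

set_option linter.dupNamespace false

noncomputable section

open Set MeasureTheory Filter Complex
open scoped Real Topology ComplexConjugate ArithmeticFunction.vonMangoldt

namespace Summit.RiemannHypothesis.RiemannHypothesis.Theorems.GroundBartaFloor

open Literature.NumberTheory.LFunctions
open Summit.RiemannHypothesis.RiemannHypothesis.Theorems.GroundStatesConvergeToXi

/-! ## Pointwise bounds for the leakage kernel `κ = Φ(1 - χ)` -/

section Ker

variable {a : ℝ} {χ : ℝ → ℝ}

/-- `Φ(s) ≤ Φ(m)` whenever `0 ≤ m ≤ |s|` (`Φ` is even and decreasing on `[0, ∞)`). [folklore] -/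
theorem leakNeg_phi_le_of_le_abs {m s : ℝ} (hm : 0 ≤ m) (h : m ≤ |s|) :
    weilThetaPhi s ≤ weilThetaPhi m := by
  have h1 : weilThetaPhi |s| ≤ weilThetaPhi m :=
    gbf_weilThetaPhi_le_of_abs_le (by rwa [abs_of_nonneg hm])
  have h2 : weilThetaPhi s = weilThetaPhi |s| := by
    rcases le_or_gt 0 s with h0 | h0
    · rw [abs_of_nonneg h0]
    · rw [abs_of_neg h0, weilThetaPhi_neg]
  rw [h2]; exact h1

/-- The leakage kernel is dominated by `Φ(max a |s|)`: it vanishes on the window and is `≤ Φ(s)`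
outside. [folklore] -/
theorem leakNeg_ker_le_phi_max (hχ1 : ∀ t ∈ Icc (-a) a, χ t = 1)
    (hχ01 : ∀ t, 0 ≤ χ t ∧ χ t ≤ 1) (s : ℝ) :
    weilThetaPhi s * (1 - χ s) ≤ weilThetaPhi (max a |s|) := by
  by_cases hs : s ∈ Icc (-a) a
  · rw [leakKer_eq_zero hχ1 hs]; exact (weilThetaPhi_pos _).le
  · have hsa : a ≤ |s| := by
      by_contra h
      exact hs (abs_le.1 (le_of_lt (not_le.1 h)))
    rw [max_eq_right hsa]
    exact (leakKer_le hχ01 s).trans (leakNeg_phi_le_of_le_abs (abs_nonneg s) le_rfl)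

/-- In particular `κ ≤ Φ(a)` everywhere. [folklore] -/
theorem leakNeg_ker_le_phi_a (ha : 0 ≤ a) (hχ1 : ∀ t ∈ Icc (-a) a, χ t = 1)
    (hχ01 : ∀ t, 0 ≤ χ t ∧ χ t ≤ 1) (s : ℝ) :
    weilThetaPhi s * (1 - χ s) ≤ weilThetaPhi a :=
  (leakNeg_ker_le_phi_max hχ1 hχ01 s).trans
    (leakNeg_phi_le_of_le_abs ha ((le_max_left _ _).trans (le_abs_self _)))

/-- On the window `|u| ≤ a`: `κ(u - x) ≤ Φ(max a (|x| - a))` (since `|u - x| ≥ |x| - a`).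
[folklore] -/
theorem leakNeg_ker_shift_le (ha : 0 ≤ a) (hχ1 : ∀ t ∈ Icc (-a) a, χ t = 1)
    (hχ01 : ∀ t, 0 ≤ χ t ∧ χ t ≤ 1) {u : ℝ} (hu : u ∈ Icc (-a) a) (x : ℝ) :
    weilThetaPhi (u - x) * (1 - χ (u - x)) ≤ weilThetaPhi (max a (|x| - a)) := by
  refine (leakNeg_ker_le_phi_max hχ1 hχ01 (u - x)).trans
    (leakNeg_phi_le_of_le_abs (le_max_of_le_left ha) ?_)
  rw [abs_of_nonneg (le_max_of_le_left ha)]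
  refine max_le_max le_rfl ?_
  have hu' : |u| ≤ a := abs_le.2 ⟨hu.1, hu.2⟩
  have := abs_sub_abs_le_abs_sub x u
  rw [abs_sub_comm x u] at this
  linarith

end Ker

/-! ## Pointwise bounds for the leakage function `F(x) = ∫ w(u) κ(u - x) du` -/

section Fun

variable {a : ℝ} {w χ : ℝ → ℝ}

/-- The real leakage function, with the kernel argument written as `u - x`. [folklore] -/
theorem leakNeg_leakFun_eq (w χ : ℝ → ℝ) (x : ℝ) :
    (∫ u, w u * (weilThetaPhi (-(x - u)) * (1 - χ (-(x - u))))) =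
      ∫ u, w u * (weilThetaPhi (u - x) * (1 - χ (u - x))) := by
  refine integral_congr_ae (ae_of_all _ fun u => ?_)
  simp only [neg_sub]

/-- **`L¹` bound:** `F(x) ≤ Φ(max a (|x| - a)) ∫ w` for `w ≥ 0` vanishing off `[-a, a]`. [folklore] -/
theorem leakNeg_leakFun_le_l1 (ha : 0 ≤ a) (hwi : Integrable w) (hw0 : ∀ t, 0 ≤ w t)
    (hws : ∀ t, t ∉ Icc (-a) a → w t = 0) (hχ1 : ∀ t ∈ Icc (-a) a, χ t = 1)
    (hχ01 : ∀ t, 0 ≤ χ t ∧ χ t ≤ 1) (x : ℝ) :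
    (∫ u, w u * (weilThetaPhi (-(x - u)) * (1 - χ (-(x - u))))) ≤
      weilThetaPhi (max a (|x| - a)) * ∫ u, w u := by
  rw [leakNeg_leakFun_eq, ← integral_const_mul]
  refine integral_mono_of_nonneg (ae_of_all _ fun u => mul_nonneg (hw0 u) (leakKer_nonneg hχ01 _))
    (hwi.const_mul _) (ae_of_all _ fun u => ?_)
  dsimp only
  by_cases hu : u ∈ Icc (-a) a
  · rw [mul_comm (weilThetaPhi _) (w u)]
    exact mul_le_mul_of_nonneg_left (leakNeg_ker_shift_le ha hχ1 hχ01 hu x) (hw0 u)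
  · rw [hws u hu]; simp

/-- Cauchy–Schwarz on an interval: `∫ 𝟙_{[c, c+t)} w ≤ √t √(∫ w²)` for `w ≥ 0` in `L²`, `t ≥ 0`.
[folklore] -/
theorem leakNeg_integral_indicator_mul_le (hw2 : MemLp w 2) (hw0 : ∀ t, 0 ≤ w t) {c t : ℝ}
    (ht : 0 ≤ t) :
    ∫ u, (Icc c (c + t)).indicator (fun _ => (1 : ℝ)) u * w u ≤
      Real.sqrt t * Real.sqrt (∫ u, w u ^ 2) := by
  have hS : MeasurableSet (Icc c (c + t)) := measurableSet_Icc
  have hvol : (volume : Measure ℝ) (Icc c (c + t)) ≠ ⊤ := measure_Icc_lt_top.ne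
  have hf : MemLp ((Icc c (c + t)).indicator fun _ => (1 : ℝ)) (ENNReal.ofReal 2) volume := by
    rw [ENNReal.ofReal_ofNat]
    exact memLp_indicator_const 2 hS (1 : ℝ) (Or.inr hvol)
  have hg : MemLp w (ENNReal.ofReal 2) volume := by rw [ENNReal.ofReal_ofNat]; exact hw2
  have hind0 : ∀ u, 0 ≤ (Icc c (c + t)).indicator (fun _ => (1 : ℝ)) u := fun u => by
    by_cases hu : u ∈ Icc c (c + t)
    · rw [indicator_of_mem hu]; exact zero_le_one
    · rw [indicator_of_notMem hu]
  have h := integral_mul_le_Lp_mul_Lq_of_nonneg Real.HolderConjugate.two_two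
    (ae_of_all _ hind0) (ae_of_all _ hw0) hf hg
  have h1 : ∫ u, (Icc c (c + t)).indicator (fun _ => (1 : ℝ)) u ^ (2 : ℝ) = t := by
    have e : (fun u => (Icc c (c + t)).indicator (fun _ => (1 : ℝ)) u ^ (2 : ℝ)) =
        (Icc c (c + t)).indicator 1 := by
      funext u
      by_cases hu : u ∈ Icc c (c + t)
      · rw [indicator_of_mem hu, indicator_of_mem hu, Pi.one_apply, Real.one_rpow]
      · rw [indicator_of_notMem hu, indicator_of_notMem hu,
          Real.zero_rpow (by norm_num : (2 : ℝ) ≠ 0)]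
    rw [e, integral_indicator_one hS, Real.volume_real_Icc_of_le (by linarith)]
    ring
  have h2 : ∫ u, w u ^ (2 : ℝ) = ∫ u, w u ^ 2 := by
    refine integral_congr_ae (ae_of_all _ fun u => ?_)
    exact Real.rpow_two (w u)
  rw [h1, h2] at h
  rw [Real.sqrt_eq_rpow, Real.sqrt_eq_rpow]
  simpa only [one_div] using h

/-- **`L²` bound near the right edge:** for `t ≥ 0`, `F(t) ≤ Φ(a) √t √(∫ w²)` — the kernel
`κ(u - t)` vanishes unless `u < t - a`, a collar of width `t` at the left edge. [folklore] -/
theorem leakNeg_leakFun_le_l2 (ha : 0 ≤ a) (hwi : Integrable w) (hw2 : MemLp w 2)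
    (hw0 : ∀ t, 0 ≤ w t) (hws : ∀ t, t ∉ Icc (-a) a → w t = 0)
    (hχ1 : ∀ t ∈ Icc (-a) a, χ t = 1) (hχ01 : ∀ t, 0 ≤ χ t ∧ χ t ≤ 1) {t : ℝ} (ht : 0 ≤ t) :
    (∫ u, w u * (weilThetaPhi (-(t - u)) * (1 - χ (-(t - u))))) ≤
      weilThetaPhi a * (Real.sqrt t * Real.sqrt (∫ u, w u ^ 2)) := by
  rw [leakNeg_leakFun_eq]
  set S : Set ℝ := Icc (-a) (-a + t) with hSdef
  have hptw : ∀ u, w u * (weilThetaPhi (u - t) * (1 - χ (u - t))) ≤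
      weilThetaPhi a * (S.indicator (fun _ => (1 : ℝ)) u * w u) := by
    intro u
    by_cases hu : u ∈ Icc (-a) a
    · by_cases hut : u < -a + t
      · have hmem : u ∈ S := ⟨hu.1, hut.le⟩
        rw [indicator_of_mem hmem, one_mul, mul_comm (weilThetaPhi a)]
        exact mul_le_mul_of_nonneg_left (leakNeg_ker_le_phi_a ha hχ1 hχ01 _) (hw0 u)
      · have hin : u - t ∈ Icc (-a) a := ⟨by linarith [not_lt.1 hut], by linarith [hu.2]⟩
        rw [leakKer_eq_zero hχ1 hin, mul_zero]
        exact mul_nonneg (weilThetaPhi_pos a).le (mul_nonneg (by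
          by_cases h : u ∈ S
          · rw [indicator_of_mem h]; exact zero_le_one
          · rw [indicator_of_notMem h]) (hw0 u))
    · rw [hws u hu, zero_mul, mul_zero, mul_zero]
  have hInt : Integrable fun u => weilThetaPhi a * (S.indicator (fun _ => (1 : ℝ)) u * w u) := by
    refine (Integrable.bdd_mul (c := 1) hwi ?_ (ae_of_all _ fun u => ?_)).const_mul _
    · exact (aestronglyMeasurable_const.indicator measurableSet_Icc)
    · by_cases h : u ∈ S
      · rw [indicator_of_mem h]; simp
      · rw [indicator_of_notMem h]; simp
  calc (∫ u, w u * (weilThetaPhi (u - t) * (1 - χ (u - t))))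
      ≤ ∫ u, weilThetaPhi a * (S.indicator (fun _ => (1 : ℝ)) u * w u) :=
        integral_mono_of_nonneg (ae_of_all _ fun u => mul_nonneg (hw0 u) (leakKer_nonneg hχ01 _))
          hInt (ae_of_all _ hptw)
    _ = weilThetaPhi a * ∫ u, S.indicator (fun _ => (1 : ℝ)) u * w u := integral_const_mul _ _
    _ ≤ weilThetaPhi a * (Real.sqrt t * Real.sqrt (∫ u, w u ^ 2)) :=
        mul_le_mul_of_nonneg_left (leakNeg_integral_indicator_mul_le hw2 hw0 ht)
          (weilThetaPhi_pos a).le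

/-- **`L²` bound near the left edge:** for `t ≥ 0`, `F(-t) ≤ Φ(a) √t √(∫ w²)`. [folklore] -/
theorem leakNeg_leakFun_neg_le_l2 (ha : 0 ≤ a) (hwi : Integrable w) (hw2 : MemLp w 2)
    (hw0 : ∀ t, 0 ≤ w t) (hws : ∀ t, t ∉ Icc (-a) a → w t = 0)
    (hχ1 : ∀ t ∈ Icc (-a) a, χ t = 1) (hχ01 : ∀ t, 0 ≤ χ t ∧ χ t ≤ 1) {t : ℝ} (ht : 0 ≤ t) :
    (∫ u, w u * (weilThetaPhi (-(-t - u)) * (1 - χ (-(-t - u))))) ≤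
      weilThetaPhi a * (Real.sqrt t * Real.sqrt (∫ u, w u ^ 2)) := by
  rw [leakNeg_leakFun_eq]
  set S : Set ℝ := Icc (a - t) (a - t + t) with hSdef
  have hptw : ∀ u, w u * (weilThetaPhi (u - -t) * (1 - χ (u - -t))) ≤
      weilThetaPhi a * (S.indicator (fun _ => (1 : ℝ)) u * w u) := by
    intro u
    by_cases hu : u ∈ Icc (-a) a
    · by_cases hut : a - t < u
      · have hmem : u ∈ S := ⟨hut.le, by linarith [hu.2]⟩
        rw [indicator_of_mem hmem, one_mul, mul_comm (weilThetaPhi a)]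
        exact mul_le_mul_of_nonneg_left (leakNeg_ker_le_phi_a ha hχ1 hχ01 _) (hw0 u)
      · have hin : u - -t ∈ Icc (-a) a := ⟨by linarith [hu.1], by linarith [not_lt.1 hut]⟩
        rw [leakKer_eq_zero hχ1 hin, mul_zero]
        exact mul_nonneg (weilThetaPhi_pos a).le (mul_nonneg (by
          by_cases h : u ∈ S
          · rw [indicator_of_mem h]; exact zero_le_one
          · rw [indicator_of_notMem h]) (hw0 u))
    · rw [hws u hu, zero_mul, mul_zero, mul_zero]
  have hInt : Integrable fun u => weilThetaPhi a * (S.indicator (fun _ => (1 : ℝ)) u * w u) := by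
    refine (Integrable.bdd_mul (c := 1) hwi ?_ (ae_of_all _ fun u => ?_)).const_mul _
    · exact (aestronglyMeasurable_const.indicator measurableSet_Icc)
    · by_cases h : u ∈ S
      · rw [indicator_of_mem h]; simp
      · rw [indicator_of_notMem h]; simp
  calc (∫ u, w u * (weilThetaPhi (u - -t) * (1 - χ (u - -t))))
      ≤ ∫ u, weilThetaPhi a * (S.indicator (fun _ => (1 : ℝ)) u * w u) :=
        integral_mono_of_nonneg (ae_of_all _ fun u => mul_nonneg (hw0 u) (leakKer_nonneg hχ01 _))
          hInt (ae_of_all _ hptw)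
    _ = weilThetaPhi a * ∫ u, S.indicator (fun _ => (1 : ℝ)) u * w u := integral_const_mul _ _
    _ ≤ weilThetaPhi a * (Real.sqrt t * Real.sqrt (∫ u, w u ^ 2)) :=
        mul_le_mul_of_nonneg_left (leakNeg_integral_indicator_mul_le hw2 hw0 ht)
          (weilThetaPhi_pos a).le

end Fun

/-! ## The prime majorant `Π_a = 2 Σ' Λ(n) n^{-1/2} Φ(max a (log n - a))` -/

/-- Summability of `Λ(n) n^{-1/2} Φ(max a (log n - a))`: `Φ(max a (log n - a)) ≤ C e^{a} e^{-log n}`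
(`Φ ≤ C e^{-|t|}`), and `Σ Λ(n) n^{-1/2} e^{-log n} < ∞`. [folklore] -/
theorem leakNeg_summable_primeMajorant (a : ℝ) :
    Summable fun n : ℕ => (Λ n : ℝ) / Real.sqrt n * weilThetaPhi (max a (Real.log n - a)) := by
  obtain ⟨C, hC0, hC⟩ := leakSign_phi_le_exp
  have hs := (uniformBound_summable_vonMangoldt (b := 1) (by norm_num)).mul_left (C * Real.exp a)
  refine Summable.of_nonneg_of_le (fun n => mul_nonneg
    (div_nonneg ArithmeticFunction.vonMangoldt_nonneg (Real.sqrt_nonneg _)) (weilThetaPhi_pos _).le)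
    (fun n => ?_) hs
  have h1 : weilThetaPhi (max a (Real.log n - a)) ≤
      C * Real.exp a * Real.exp (-(1 * Real.log n)) := by
    refine (hC _).trans ?_
    rw [mul_assoc, ← Real.exp_add]
    refine mul_le_mul_of_nonneg_left (Real.exp_le_exp.2 ?_) hC0
    have : Real.log n - a ≤ |max a (Real.log n - a)| :=
      (le_max_right _ _).trans (le_abs_self _)
    linarith
  calc (Λ n : ℝ) / Real.sqrt n * weilThetaPhi (max a (Real.log n - a))
      ≤ (Λ n : ℝ) / Real.sqrt n * (C * Real.exp a * Real.exp (-(1 * Real.log n))) :=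
        mul_le_mul_of_nonneg_left h1
          (div_nonneg ArithmeticFunction.vonMangoldt_nonneg (Real.sqrt_nonneg _))
    _ = C * Real.exp a * ((Λ n : ℝ) / Real.sqrt n * Real.exp (-(1 * Real.log n))) := by ring

/-- `Π_a ≥ 0`. [folklore] -/
theorem leakNeg_primeMajorant_nonneg (a : ℝ) :
    0 ≤ 2 * ∑' n : ℕ, (Λ n : ℝ) / Real.sqrt n * weilThetaPhi (max a (Real.log n - a)) :=
  mul_nonneg zero_le_two (tsum_nonneg fun _ => mul_nonneg
    (div_nonneg ArithmeticFunction.vonMangoldt_nonneg (Real.sqrt_nonneg _)) (weilThetaPhi_pos _).le)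

/-! ## Two elementary integrals for the archimedean majorant -/

/-- `∫_{(0,1]} t^{-1/2} dt = 2`. [folklore] -/
theorem leakNeg_integral_rpow_neg_half : ∫ t in Ioc (0 : ℝ) 1, t ^ (-(1 / 2 : ℝ)) = 2 := by
  rw [← intervalIntegral.integral_of_le zero_le_one, integral_rpow (Or.inl (by norm_num))]
  norm_num

/-- `∫_{(0,∞)} e^{-t/2} dt = 2`. [folklore] -/
theorem leakNeg_integral_exp_neg_half : ∫ t in Ioi (0 : ℝ), Real.exp (-(1 / 2) * t) = 2 := by
  rw [integral_exp_mul_Ioi (by norm_num) 0]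
  norm_num

/-- On `(0, 1]`: `e^{t/2}/(2 sinh t) · (2K√t) ≤ 2K t^{-1/2}` for `K ≥ 0` (`sinh t ≥ t`,
`e^{1/2} ≤ 2`). [folklore] -/
theorem leakNeg_arch_majorant_small {t K : ℝ} (ht0 : 0 < t) (ht1 : t ≤ 1) (hK : 0 ≤ K) :
    Real.exp (t / 2) * (2 * (K * Real.sqrt t)) / (2 * Real.sinh t) ≤
      2 * K * t ^ (-(1 / 2 : ℝ)) := by
  have hsinh : t ≤ Real.sinh t := Real.self_le_sinh_iff.2 ht0.le
  have hsinh0 : 0 < Real.sinh t := Real.sinh_pos_iff.2 ht0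
  have hexp : Real.exp (t / 2) ≤ 2 := by
    have h1 : Real.exp (t / 2) ≤ Real.exp (1 / 2 : ℝ) := Real.exp_le_exp.2 (by linarith)
    have h2 : Real.exp (1 / 2 : ℝ) ≤ 2 := by
      have h3 : Real.exp (1 / 2 : ℝ) ^ 2 = Real.exp 1 := by
        rw [← Real.exp_nat_mul]; norm_num
      nlinarith [Real.exp_one_lt_d9, Real.exp_pos (1 / 2 : ℝ)]
    exact h1.trans h2
  have hsq : Real.sqrt t * Real.sqrt t = t := Real.mul_self_sqrt ht0.le
  have hrpow : t ^ (-(1 / 2 : ℝ)) = 1 / Real.sqrt t := by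
    rw [Real.rpow_neg ht0.le, ← Real.sqrt_eq_rpow, one_div]
  have hst0 : 0 < Real.sqrt t := Real.sqrt_pos.2 ht0
  rw [hrpow, div_le_iff₀ (by positivity)]
  -- `e^{t/2} · 2K√t ≤ 2K/√t · 2 sinh t`, using `√t · √t = t ≤ sinh t` and `e^{t/2} ≤ 2`
  have key : Real.exp (t / 2) * (2 * (K * Real.sqrt t)) * Real.sqrt t ≤
      2 * K * (2 * Real.sinh t) := by
    calc Real.exp (t / 2) * (2 * (K * Real.sqrt t)) * Real.sqrt t
        = Real.exp (t / 2) * (2 * K) * (Real.sqrt t * Real.sqrt t) := by ring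
      _ = Real.exp (t / 2) * (2 * K) * t := by rw [hsq]
      _ ≤ 2 * (2 * K) * Real.sinh t := by
          have : Real.exp (t / 2) * (2 * K) * t ≤ 2 * (2 * K) * t :=
            mul_le_mul_of_nonneg_right (mul_le_mul_of_nonneg_right hexp (by positivity)) ht0.le
          exact this.trans (mul_le_mul_of_nonneg_left hsinh (by positivity))
      _ = 2 * K * (2 * Real.sinh t) := by ring
  have e1 : 2 * K * (1 / Real.sqrt t) * (2 * Real.sinh t) =
      (2 * K * (2 * Real.sinh t)) / Real.sqrt t := by field_simp
  rw [e1, le_div_iff₀ hst0]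
  exact key

/-- On `(1, ∞)`: `e^{t/2}/(2 sinh t) · (2L) ≤ 4L e^{-t/2}` for `L ≥ 0` (`2 sinh t ≥ e^{t}/2` for
`t ≥ 1`). [folklore] -/
theorem leakNeg_arch_majorant_large {t L : ℝ} (ht1 : 1 < t) (hL : 0 ≤ L) :
    Real.exp (t / 2) * (2 * L) / (2 * Real.sinh t) ≤ 4 * L * Real.exp (-(1 / 2) * t) := by
  have hsinh0 : 0 < Real.sinh t := Real.sinh_pos_iff.2 (by linarith)
  rw [div_le_iff₀ (by positivity), Real.sinh_eq]
  -- `e^{t/2} · 2L ≤ 4L e^{-t/2} (e^t - e^{-t})`, i.e. `2 e^{t/2} ≤ 4(e^{t/2} - e^{-3t/2})`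
  have h1 : Real.exp (-(1 / 2) * t) * Real.exp t = Real.exp (t / 2) := by
    rw [← Real.exp_add]; congr 1; ring
  have h2 : Real.exp (-(1 / 2) * t) * Real.exp (-t) = Real.exp (-(3 / 2) * t) := by
    rw [← Real.exp_add]; congr 1; ring
  have h3 : 2 * Real.exp (-(3 / 2) * t) ≤ Real.exp (t / 2) := by
    -- `2 ≤ e^{2t}` since `t > 1`: `e^{2t} ≥ 1 + 2t ≥ 3`
    have h4 : Real.exp (t / 2) = Real.exp (-(3 / 2) * t) * Real.exp (2 * t) := by
      rw [← Real.exp_add]; congr 1; ring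
    have h5 : (2 : ℝ) ≤ Real.exp (2 * t) := by
      have := Real.add_one_le_exp (2 * t); linarith
    rw [h4]
    have h6 := Real.exp_pos (-(3 / 2) * t)
    nlinarith
  have e : 4 * L * Real.exp (-(1 / 2) * t) * (2 * ((Real.exp t - Real.exp (-t)) / 2)) =
      4 * L * (Real.exp (-(1 / 2) * t) * Real.exp t - Real.exp (-(1 / 2) * t) * Real.exp (-t)) := by
    ring
  rw [e, h1, h2]
  nlinarith [Real.exp_pos (t / 2), Real.exp_pos (-(3 / 2) * t)]

end Summit.RiemannHypothesis.RiemannHypothesis.Theorems.GroundBartaFloor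

end
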